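import Summits.Ventures.QEC.Census.FoldTowerK
import HarnessLib

/-!
# Fold certificate of `[[288,12,18]]` — zero / lift node checks, file 0: zero2, zero3, zero4, lift2a, lift2b, lift3, lift4

Kernel computation only (`decide +kernel`, standard axioms): the zero nodes of levels 2–4 (`zeroCheckS`) and the special
low-weight (row-class) nodes (`liftCheckS` with the translated lifts `STS*`); assembled in the closer via `FoldTowerSound`.
-/

set_option maxRecDepth 100000

namespace Summit.Ventures.QEC.Census.Fold.Tower

open Summit.Ventures.QEC.Census Summit.Ventures.QEC.Census.Fold

set_option maxHeartbeats 400000000 in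
/-- `zero2` (kernel computation / assembly step; see the module docstring). -/
theorem zero2 : zeroCheckS G2 16 T36_10 k2 = true := by decide +kernel

set_option maxHeartbeats 400000000 in
/-- `zero3` (kernel computation / assembly step; see the module docstring). -/
theorem zero3 : zeroCheckS G3 16 T72_10 k3 = true := by decide +kernel

set_option maxHeartbeats 400000000 in
/-- `zero4` (kernel computation / assembly step; see the module docstring). -/
theorem zero4 : zeroCheckS G4 16 T144 k4 = true := by decide +kernel

set_option maxHeartbeats 400000000 in
/-- `lift2a` (kernel computation / assembly step; see the module docstring). -/
theorem lift2a : liftCheckS G2 16 STS2a T36_10 k2 = true := by decide +kernel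

set_option maxHeartbeats 400000000 in
/-- `lift2b` (kernel computation / assembly step; see the module docstring). -/
theorem lift2b : liftCheckS G2 16 STS2b T36_10 k2 = true := by decide +kernel

set_option maxHeartbeats 400000000 in
/-- `lift3` (kernel computation / assembly step; see the module docstring). -/
theorem lift3 : liftCheckS G3 16 STS3 T72_10 k3 = true := by decide +kernel

set_option maxHeartbeats 400000000 in
/-- `lift4` (kernel computation / assembly step; see the module docstring). -/
theorem lift4 : liftCheckS G4 16 STS4 (T144.filter fun c => popc 144 c ≤ 11) k4 = true := by decide +kernel


end Summit.Ventures.QEC.Census.Fold.Tower
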